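import Summits.Ventures.CertifiedManyBodySolver.Theorems.M3x2EdgeSplitSymReplayPackedKron
import Summits.Ventures.CertifiedManyBodySolver.Theorems.M3x2EdgeSplitSymReplaySideFactsWf
import HarnessLib

/-!
# SymReplay — lever (κ) in the enumerator: `shareRFastMFK` (Kronecker dots) `= shareRFastMFD` (dense dots), unconditionally

(team lb-sym, cell hub-lb; hub-lb-sym-eng-4 g3, 2026-08-28; ADDITIVE on `…PackedKron` (the Kronecker dot `kdot` and `kdot_mkKRow`),
`…OutRouteMFD` (dense enumerator of record after β⁺) and `…SideFactsWf` (its side-fact-free closing `…PMFD0'`); nothing landed is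
touched.)

WHAT.  Per R-block, once per module: the offset bound `blockAbsBound B` (one more than the largest `|entry|`), the digit width
`blockBits B` (so that `blockWidth B · (2M−1)² < 2^b`, by `Nat.log2`), and the Kronecker rows `blockRowsK B` (each dense row of
`blockRowsD B` packed by `mkKRow`).  Per hit: `stepOptK` reads `kdot` instead of `ddot`.  Every hypothesis of `kdot_mkKRow` holds BY
CONSTRUCTION (dense rows have length `blockWidth`, entries and the filled zeros are below the bound, the width inequality is the
defining property of `blockBits`), so the bridge **`shareRFastMFK_eq : shareRFastMFK … = shareRFastMFD …`** is UNCONDITIONAL and the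
closing **`energyDensity_ge_of_outroutePMFK0`** has `…PMF0`'s binder list exactly (via `…PMFD0'`).  MODULE GRAMMAR: per module
`out_m : pisZeroT (pcanonNFZHBZT lo hi PackedNF.oracleV3 (PackedNF.encP lo hi (shareRFastMFK momSpecC cert gbs tabC κ₂ J L (m / L)
(m % L)))) = true := by native_decide`, fact of record by `pisZero_of_T` + `shareRFastMFK_eq`.  Std axioms; no `native_decide` here.
MEASURED (interpreted): rung-V module 0 (coarse key, J 8, L 1) body `shareRFastMFD` 15.6 s vs `shareRFastMFK` 15.8 s — a WASH at
rung V's shape (39-bit entries, b = 84, r ≤ 130), lists equal; per-dot law at the E₁ K-32 shape (synthetic rows |entry| < 2^29,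
b = 65–68) r = 32 / 64 / 100 / 148 / 233: 9 / 14 / 21 / 33 / 41 → 3 / 3 / 8 / 8 / 15 µs (÷3–4) ⇒ ≈ −13 µs per product at r̄ = 102.6;
the E₁ lander picks MFD or MFK by one bench on the real rows — both close through `…PMF0`'s binder list.

HONEST FRAMING: an interpreted replay-COST lever with its equality proof; certifies nothing; no bound of record moves; no summit or
crux statement is proved here; nothing here predicts superconductivity.
-/

namespace Summit.Ventures.CertifiedManyBodySolver.Theorems.SymReplay

open Literature.MathematicalPhysics.QuantumLattice
open Literature.MathematicalPhysics.QuantumLattice.HubbardWave0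
open Literature.MathematicalPhysics.QuantumLattice.ThermodynamicLimit
open Literature.Probability.LatticeModels
open Literature.MathematicalPhysics.QuantumManyBody.StateRelaxation
open Summit.Ventures.CertifiedManyBodySolver.Theorems.WardSlot

/-! ##### (a) per-block Kronecker data and their constructive properties -/

/-- One more than the largest `|entry|` of the block's integerised rows (the offset `M`; at least `1`). -/
def blockAbsBound (B : GramBlockR) : ℤ :=
  (blockRowsZ B).foldl (fun m r => r.foldl (fun m e => max m (|e.1| + 1)) m) 1

/-- Digit width `b` with `blockWidth B · (2M−1)² < 2^b`. -/
def blockBits (B : GramBlockR) : ℕ :=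
  Nat.log2 (blockWidth B * (2 * blockAbsBound B - 1).toNat * (2 * blockAbsBound B - 1).toNat) + 1

/-- Kronecker-encoded dense rows of a block. -/
def blockRowsK (B : GramBlockR) : List KRow := (blockRowsD B).map (mkKRow (blockBits B) (blockAbsBound B))

/-- The defining inequality of `blockBits`. -/
theorem blockBits_spec (B : GramBlockR) :
    blockWidth B * (2 * blockAbsBound B - 1).toNat * (2 * blockAbsBound B - 1).toNat < 2 ^ blockBits B :=
  Nat.lt_log2_self

/-- The inner `max` fold dominates its start value. -/
theorem le_foldl_maxAbs (r : List (ℤ × ℕ)) : ∀ m : ℤ, m ≤ r.foldl (fun m e => max m (|e.1| + 1)) m := by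
  induction r with
  | nil => intro m; exact le_rfl
  | cons e r ih => intro m; exact le_trans (le_max_left _ _) (ih _)

/-- Every entry of a row is strictly below the row's `max (|·|+1)` fold. -/
theorem abs_lt_foldl_maxAbs (r : List (ℤ × ℕ)) : ∀ (m : ℤ), ∀ e ∈ r, |e.1| < r.foldl (fun m e => max m (|e.1| + 1)) m := by
  induction r with
  | nil => intro m e he; simp at he
  | cons e' r ih =>
    intro m e he
    rw [List.foldl_cons]
    rcases List.mem_cons.1 he with rfl | he
    · exact lt_of_lt_of_le (lt_of_lt_of_le (lt_add_one _) (le_max_right _ _)) (le_foldl_maxAbs r _)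
    · exact ih _ e he

/-- The outer fold dominates its start value. -/
theorem le_foldl_maxAbsRows (rows : List (List (ℤ × ℕ))) :
    ∀ m : ℤ, m ≤ rows.foldl (fun m r => r.foldl (fun m e => max m (|e.1| + 1)) m) m := by
  induction rows with
  | nil => intro m; exact le_rfl
  | cons r rows ih => intro m; exact le_trans (le_foldl_maxAbs r m) (ih _)

/-- Every entry of every row is strictly below the rows' fold. -/
theorem abs_lt_foldl_maxAbsRows (rows : List (List (ℤ × ℕ))) :
    ∀ (m : ℤ), ∀ r ∈ rows, ∀ e ∈ r, |e.1| < rows.foldl (fun m r => r.foldl (fun m e => max m (|e.1| + 1)) m) m := by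
  induction rows with
  | nil => intro m r hr; simp at hr
  | cons r' rows ih =>
    intro m r hr e he
    rw [List.foldl_cons]
    rcases List.mem_cons.1 hr with rfl | hr
    · exact lt_of_lt_of_le (abs_lt_foldl_maxAbs r m e he) (le_foldl_maxAbsRows rows _)
    · exact ih _ r hr e he

/-- `1 ≤ blockAbsBound B`. -/
theorem one_le_blockAbsBound (B : GramBlockR) : 1 ≤ blockAbsBound B := le_foldl_maxAbsRows _ 1

/-- Every integerised entry is below the block's offset bound in absolute value. -/
theorem abs_lt_blockAbsBound (B : GramBlockR) (rz : List (ℤ × ℕ)) (hrz : rz ∈ blockRowsZ B) (e : ℤ × ℕ) (he : e ∈ rz) :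
    |e.1| < blockAbsBound B :=
  abs_lt_foldl_maxAbsRows _ 1 rz hrz e he

/-- Entries of a densified row are zeros or entries of the sparse row. -/
theorem mem_dvF : ∀ (f k : ℕ) (rz : List (ℤ × ℕ)), ∀ x ∈ dvF k f rz, x = 0 ∨ ∃ e ∈ rz, e.1 = x
  | 0, k, rz, x, hx => by simp [dvF] at hx
  | f + 1, k, [], x, hx => by
    rw [dvF, List.mem_cons] at hx
    rcases hx with rfl | hx
    · exact Or.inl rfl
    · rcases mem_dvF f (k + 1) [] x hx with h | ⟨e, he, _⟩
      · exact Or.inl h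
      · simp at he
  | f + 1, k, (a, i) :: r, x, hx => by
    rw [dvF] at hx
    split_ifs at hx with hi
    · rcases List.mem_cons.1 hx with rfl | hx
      · exact Or.inr ⟨_, List.mem_cons_self, rfl⟩
      · rcases mem_dvF f (k + 1) r x hx with h | ⟨e, he, h⟩
        · exact Or.inl h
        · exact Or.inr ⟨e, List.mem_cons_of_mem _ he, h⟩
    · rcases List.mem_cons.1 hx with rfl | hx
      · exact Or.inl rfl
      · exact mem_dvF f (k + 1) ((a, i) :: r) x hx

/-- A densified row has exactly the requested length. -/
theorem length_dvF : ∀ (f k : ℕ) (rz : List (ℤ × ℕ)), (dvF k f rz).length = f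
  | 0, k, rz => by simp [dvF]
  | f + 1, k, [] => by rw [dvF, List.length_cons, length_dvF f (k + 1) []]
  | f + 1, k, (a, i) :: r => by
    rw [dvF]
    split_ifs
    · rw [List.length_cons, length_dvF f (k + 1) r]
    · rw [List.length_cons, length_dvF f (k + 1) ((a, i) :: r)]

/-- **Every dense row of a block meets the hypotheses of `kdot_mkKRow`**: length `blockWidth`, entries in `[−M, M)`. -/
theorem blockRowsD_spec (B : GramBlockR) (xD : List ℤ) (hx : xD ∈ blockRowsD B) :
    xD.length = blockWidth B ∧ ∀ x ∈ xD, -blockAbsBound B ≤ x ∧ x < blockAbsBound B := by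
  obtain ⟨rz, hrz, rfl⟩ := List.mem_map.1 hx
  refine ⟨length_dvF _ _ _, fun x hx' => ?_⟩
  have h1 := one_le_blockAbsBound B
  rcases mem_dvF _ _ _ x hx' with rfl | ⟨e, he, rfl⟩
  · constructor <;> omega
  · have := abs_lt_blockAbsBound B rz hrz e he
    rw [abs_lt] at this
    exact ⟨this.1.le, this.2⟩

/-! ##### (b) the Kronecker enumerator -/

/-- Per-hit step with a KRONECKER dot (shift `sh` and mask hoisted per block). -/
def stepOptK (sh mask : ℕ) (Mo : ℤ) (r : ℕ) (aK : KRow) (kb : ℚ) (t : ℚ × Word) (x : KRow × (ℚ × Word)) :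
    Option (ℚ × Word) :=
  let g := kdotP sh mask Mo r aK x.1
  if g = 0 then none else some (kb * (g : ℚ) * (t.1 * x.2.1), t.2 ++ x.2.2)

section KronRows

variable {M : Type} [DecidableEq M] [Hashable M]

/-- Tagged basis terms with Kronecker rows. -/
def wflatK (qk : List (QPoly × KRow)) : List (KRow × (ℚ × Word)) :=
  qk.flatMap fun p => p.1.map fun t' => (p.2, t')

/-- **One representative row, secondary test before the KRONECKER dot.** -/
def rowFastFK (S : MomSpec M) (sh mask : ℕ) (Mo : ℤ) (r : ℕ) (a : QPoly × KRow)
    (wmap : Std.HashMap M (List (KRow × (ℚ × Word)))) (kb : ℚ) (T : List M) (P₂ : Word → Bool) : QPoly :=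
  (padj a.1).flatMap fun t =>
    T.flatMap fun mt =>
      (wmap.getD (S.sub mt (mom S t.2)) []).filterMap fun x =>
        if P₂ (t.2 ++ x.2.2) then stepOptK sh mask Mo r a.2 kb t x else none

/-- **R-part of sub-module `(i, f)` with Kronecker dots** (twin of `shareRWithMFD`). -/
def shareRWithMFK (S : MomSpec M) (K : SymCertR) (gbs : List (List QPoly)) (T : List M) (P₂ : Word → Bool) : QPoly :=
  (K.gramR.zip gbs).flatMap fun Bg =>
    let D := blockDen Bg.1
    let b := blockBits Bg.1
    let Mo := blockAbsBound Bg.1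
    let r := blockWidth Bg.1
    let sh := b * (r - 1)
    let mask := 2 ^ b - 1
    let rk := blockRowsK Bg.1
    let kb : ℚ := -1 * ((Bg.1.moves.length : ℚ) * Bg.1.scale) / ((D : ℚ) * D)
    let wmap := bucketBy (fun x : KRow × (ℚ × Word) => mom S x.2.2) (wflatK (Bg.2.zip rk))
    (Bg.1.reps.zip rk).flatMap fun a => rowFastFK S sh mask Mo r a wmap kb T P₂

/-- **Sub-module `(i, f)`'s share with Kronecker dots** (twin of `shareRFastMFD`; same list, `shareRFastMFK_eq`). -/
def shareRFastMFK (S : MomSpec M) (K : SymCertR) (gbs : List (List QPoly)) (hm : MomTable M) (κ₂ : Word → ℕ)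
    (J L i f : ℕ) : QPoly :=
  let P := wordPred (inSlotW (momKey S hm) J i)
  let P₂ : Word → Bool := fun w => κ₂ w % L == f
  (baseShareF K.toSymCert P).filter (wordPred P₂) ++
  ((pscale (-1) (K.gramM.flatMap fun B => (gramBlockPoly B).filter P)).filter (wordPred P₂) ++
    shareRWithMFK S K gbs (targetsM hm J i) P₂)

/-! ##### (c) the bridge to the dense enumerator and the closing -/

/-- The Kronecker dot on encoded rows of length `0` is `0`, like the dense dot. -/
theorem kdot_mkKRow_nil (b : ℕ) (Mo : ℤ) : kdot b Mo 0 (mkKRow b Mo []) (mkKRow b Mo []) = ddot [] [] := by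
  simp [kdot, kdotP, mkKRow, offDigits, evalLE, ddot]

/-- **`stepOptK` IS `stepOptD`** on rows meeting the constructive hypotheses. -/
theorem stepOptK_eq (b : ℕ) (Mo : ℤ) (r : ℕ) (hb : r * (2 * Mo - 1).toNat * (2 * Mo - 1).toNat < 2 ^ b) (aD : List ℤ)
    (ha : aD.length = r ∧ ∀ x ∈ aD, -Mo ≤ x ∧ x < Mo) (kb : ℚ) (t : ℚ × Word) (x : List ℤ × (ℚ × Word))
    (hx : x.1.length = r ∧ ∀ y ∈ x.1, -Mo ≤ y ∧ y < Mo) :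
    stepOptK (b * (r - 1)) (2 ^ b - 1) Mo r (mkKRow b Mo aD) kb t (mkKRow b Mo x.1, x.2) = stepOptD aD kb t x := by
  obtain ⟨xD, cw⟩ := x
  have hk : kdotP (b * (r - 1)) (2 ^ b - 1) Mo r (mkKRow b Mo aD) (mkKRow b Mo xD) = ddot aD xD := by
    show kdot b Mo r (mkKRow b Mo aD) (mkKRow b Mo xD) = ddot aD xD
    rcases Nat.eq_zero_or_pos r with hr | hr
    · subst hr
      have h1 : aD = [] := List.eq_nil_of_length_eq_zero ha.1
      have h2 : xD = [] := List.eq_nil_of_length_eq_zero hx.1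
      subst h1 h2
      exact kdot_mkKRow_nil b Mo
    · exact kdot_mkKRow b Mo r aD xD hr ha.1 hx.1 ha.2 hx.2 hb
  unfold stepOptK stepOptD
  simp only [hk]

/-- `wflatK` of encoded rows is the encoding of `wflatD`. -/
theorem wflatK_map (b : ℕ) (Mo : ℤ) : ∀ (qd : List (QPoly × List ℤ)),
    wflatK (qd.map fun p => (p.1, mkKRow b Mo p.2)) = (wflatD qd).map fun x => (mkKRow b Mo x.1, x.2)
  | [] => rfl
  | p :: qd => by
    have ih := wflatK_map b Mo qd
    simp only [wflatK, wflatD, List.map_cons, List.flatMap_cons, List.map_append, List.map_map] at ih ⊢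
    rw [ih]
    rfl

/-- The row of a tagged term of `wflatD qd` is a row of `qd`. -/
theorem mem_wflatD {qd : List (QPoly × List ℤ)} {x : List ℤ × (ℚ × Word)} (hx : x ∈ wflatD qd) : ∃ p ∈ qd, x.1 = p.2 := by
  simp only [wflatD, List.mem_flatMap, List.mem_map] at hx
  obtain ⟨p, hp, t', _, rfl⟩ := hx
  exact ⟨p, hp, rfl⟩

/-- **Kronecker row = dense row** when the representative row and all tagged rows meet the constructive hypotheses. -/
theorem rowFastFK_eq (S : MomSpec M) (b : ℕ) (Mo : ℤ) (r : ℕ) (hb : r * (2 * Mo - 1).toNat * (2 * Mo - 1).toNat < 2 ^ b)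
    (p : QPoly) (aD : List ℤ) (ha : aD.length = r ∧ ∀ x ∈ aD, -Mo ≤ x ∧ x < Mo) (qd : List (QPoly × List ℤ))
    (hq : ∀ q ∈ qd, q.2.length = r ∧ ∀ y ∈ q.2, -Mo ≤ y ∧ y < Mo) (kb : ℚ) (T : List M) (P₂ : Word → Bool) :
    rowFastFK S (b * (r - 1)) (2 ^ b - 1) Mo r (p, mkKRow b Mo aD) (bucketBy (fun x : KRow × (ℚ × Word) => mom S x.2.2)
        (wflatK (qd.map fun q => (q.1, mkKRow b Mo q.2)))) kb T P₂ =
      rowFastFD S (p, aD) (bucketBy (fun x : List ℤ × (ℚ × Word) => mom S x.2.2) (wflatD qd)) kb T P₂ := by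
  unfold rowFastFK rowFastFD
  refine List.flatMap_congr fun t _ => List.flatMap_congr fun mt _ => ?_
  rw [bucketBy_getD, bucketBy_getD, wflatK_map, List.filter_map, ← List.map_reverse, List.filterMap_map]
  have hf : ((fun x : KRow × (ℚ × Word) => decide (mom S x.2.2 = S.sub mt (mom S t.2))) ∘
      fun x : List ℤ × (ℚ × Word) => (mkKRow b Mo x.1, x.2)) =
      fun x => decide (mom S x.2.2 = S.sub mt (mom S t.2)) := rfl
  rw [hf]
  refine List.filterMap_congr fun x hx => ?_
  obtain ⟨q, hq', hxq⟩ := mem_wflatD (List.mem_filter.1 (List.mem_reverse.1 hx)).1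
  have hxOK : x.1.length = r ∧ ∀ y ∈ x.1, -Mo ≤ y ∧ y < Mo := hxq ▸ hq q hq'
  rw [Function.comp_apply, stepOptK_eq b Mo r hb aD ha kb t x hxOK]

/-- **Kronecker R-part = dense R-part**, unconditionally. -/
theorem shareRWithMFK_eq (S : MomSpec M) (K : SymCertR) (gbs : List (List QPoly)) (T : List M) (P₂ : Word → Bool) :
    shareRWithMFK S K gbs T P₂ = shareRWithMFD S K gbs T P₂ := by
  unfold shareRWithMFK shareRWithMFD
  refine List.flatMap_congr fun Bg _ => ?_
  have hzip : ∀ (l : List (QPoly × List ℤ)), l.map (Prod.map id (mkKRow (blockBits Bg.1) (blockAbsBound Bg.1))) =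
      l.map fun q => (q.1, mkKRow (blockBits Bg.1) (blockAbsBound Bg.1) q.2) :=
    fun l => List.map_congr_left fun q _ => by cases q; rfl
  simp only [blockRowsK, List.zip_map_right, PackedNF.flatMap_map_left, hzip]
  refine List.flatMap_congr fun a ha => ?_
  obtain ⟨p, aD⟩ := a
  have haD : aD.length = blockWidth Bg.1 ∧ ∀ x ∈ aD, -blockAbsBound Bg.1 ≤ x ∧ x < blockAbsBound Bg.1 :=
    blockRowsD_spec Bg.1 aD (List.of_mem_zip ha).2
  have hq : ∀ q ∈ Bg.2.zip (blockRowsD Bg.1), q.2.length = blockWidth Bg.1 ∧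
      ∀ y ∈ q.2, -blockAbsBound Bg.1 ≤ y ∧ y < blockAbsBound Bg.1 :=
    fun q hq => blockRowsD_spec Bg.1 q.2 (List.of_mem_zip hq).2
  exact rowFastFK_eq S _ _ _ (blockBits_spec Bg.1) p aD haD _ hq _ T P₂

/-- **THE BRIDGE: the Kronecker-dot share IS the dense-dot share** (same list, every argument). -/
theorem shareRFastMFK_eq (S : MomSpec M) (K : SymCertR) (gbs : List (List QPoly)) (hm : MomTable M) (κ₂ : Word → ℕ)
    (J L i f : ℕ) : shareRFastMFK S K gbs hm κ₂ J L i f = shareRFastMFD S K gbs hm κ₂ J L i f := by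
  unfold shareRFastMFK shareRFastMFD
  simp only [shareRWithMFK_eq]

/-- **CLOSING, Kronecker dots** (`…PMF0`'s binder list exactly, via `…PMFD0'`). -/
theorem energyDensity_ge_of_outroutePMFK0 (Sm : MomSpec M) (K : SymCertR) (hwf : wellFormed K.expand = true)
    (hRok : K.gramR.all (gramBlockROK K.frame) = true) (oP : PackedNF.PWord → PackedNF.PHint) (hm : MomTable M)
    (κ₂ : Word → ℕ) (J L : ℕ) (hJ : 0 < J) (hL : 0 < L) (lo hi : ℤ × ℤ) (hbox : boxLicence K.frame lo hi = true)
    (hcov : coverM Sm K (K.gramR.map genBasis) hm = true)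
    (hfacts : OutFactsP0 lo hi oP
      (fun m => shareRFastMFK Sm K (K.gramR.map genBasis) hm κ₂ J L (m / L) (m % L)) 0 (J * L)) :
    ((symValueR K : ℚ) : ℝ) ≤ energyDensityTT' 1 0 8 (7 / 8) := by
  have hS : (fun m => shareRFastMFK Sm K (K.gramR.map genBasis) hm κ₂ J L (m / L) (m % L)) =
      fun m => shareRFastMFD Sm K (K.gramR.map genBasis) hm κ₂ J L (m / L) (m % L) := by
    funext m; exact shareRFastMFK_eq Sm K _ hm κ₂ J L _ _
  rw [hS] at hfacts
  exact energyDensity_ge_of_outroutePMFD0' Sm K hwf hRok oP hm κ₂ J L hJ hL lo hi hbox hcov hfacts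

end KronRows

end Summit.Ventures.CertifiedManyBodySolver.Theorems.SymReplay
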